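import Summits.BirchSwinnertonDyer.BirchSwinnertonDyer.Theorems.ByReductionTypeAtTwoMultLowerHalfSelmerRank
import Summits.BirchSwinnertonDyer.BirchSwinnertonDyer.Theorems.ByReductionTypeAtTwoMultUpperHalfTower
import Summits.BirchSwinnertonDyer.BirchSwinnertonDyer.Theorems.ByReductionTypeAtTwoMultUpperHalfIntegral
import Summits.BirchSwinnertonDyer.Rank1Residual.X5.TwoAdicTargetsMultKatoIntSplit
import HarnessLib

/-!
# Route `ByReductionTypeAtTwo`, children `MultLowerHalfAtTwo` (item stmt-BirchSwinnertonDyer-19923) and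
# `MultUpperHalfAtTwo` (19922): the TOWER λ-PINCH road at a multiplicative `2` — BOTH halves of `BSD₂` per curve
# from Kato `⊗ℚ` (K11) + finite-layer certificates, on the WHOLE odd-torsion multiplicative block
# (no `2`-adic image hypothesis, no sign of `Δ`, no integral-Kato memo T-KATO2-NS/SPMULT)

HONEST FRAMING (cell `bsd-2adic`, run/shared/lean/pub/bsd-2adic/, seat `bsd-2adic-mult-3` GEN 6, HUMAN RULINGS
D-0036 / D-0054 / D-0074 row (A)): research route; THEOREMS ONLY — no definition, no new named fact, nothing
asserted, nothing booked; BSD is not proved by any of this. PARTITION (D-0054): X5@2 mult with `2 ∤ #E(ℚ)_tors`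
(K4ᵐ, RESIDUAL-MAP B1·O1; 1 680 E[2]-irreducible of the 1 976 book230 classes — the 808 NS-surjective-`Δ<0`
classes of the INT doors AND the 872 others: split, `Δ > 0`, small `2`-adic image) × p = 2 —
types-the-object-of (items 19923 / 19922 per class by ONE door); closes none by itself.

## The road (the multiplicative twin of ord-2's `KatoHalfPinch.bsdp_two_of_towerGap_of_layerSelmer`)

At a good ordinary `2` the tower lanes close `BSD₂` per class from PRINT + finite-layer certificates: the TOWER GAP
(`O1.TowerGapAtTwo W`: `X` torsion, `μ(X) = 0`) upgrades Kato's `⊗ℚ` divisibility to an integral one, the layer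
count `2^n ≤ #Sel_{2^∞}(E/ℚ_j)[2]` + Greenberg Prop. 4.14@2 give `n ≤ λ(X)`, and with `λ_an = n`, `μ_an = 0`
the pinch `char_Λ X = (ϖ·L₂)` yields both halves. Every piece has its multiplicative twin in the tree:
* integral divisibility at a multiplicative `2` from Kato `⊗ℚ` (`O1.KatoMultiplicativeDivisibilityRat W 2`, K11:
  Kato 17.13 read `⊗ℚ` at `2 ∣ N`, cell memo PROOF-MULT RC-2 PASS; the lane t42's kernel target #2) + `μ = 0` +
  `0 ≤ ord₂ ϖ`: mult-2's `Theorems.integralKato_of_katoRat_of_mu_eq_zero_of_period` (p42xxxx,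
  `…MultUpperHalfIntegral`), non-split `∃ g ∈ char X, ι g = ϖ·L` / split `∃ g ∈ char X, ι(T·g) = ϖ·L`;
* `μ = 0` from the tower gap: `Theorems.mu_eq_zero_of_towerGapAtTwo` (mult-2 GEN 3, `…MultUpperHalfTower`);
* `n ≤ λ(X)` (`X5.O1.SelmerLambdaLowerBoundAtTwo W n`) from PRINT Prop. 4.14@2 + the layer count:
  `MultSelmerRank.selmerLambdaLowerBoundAtTwo_of_layerSelmer` (this seat, p445915);
* the pinch and the `BSD₂` read-out at a non-split / split `2`: `X5.O1.charIdeal_eq_span_of_katoInt_selmerPinch_nonsplit`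
  + `missingPPartAt_two_nonsplit_of_charIdeal_eq_span` (guarded Thm-4.1 analogue, `l_v = 2` cancels MTT's `2`) /
  `charIdeal_eq_span_of_katoIntSplit_selmerPinch` + `missingPPartAt_two_split_of_charIdeal_eq_span` (A236 +
  Greenberg–Stevens at `2`).
So:
* §1 `bsdp_two_nonsplit_of_katoRat_of_towerGap_of_layerSelmer` — `BSDp W 2` at a NON-SPLIT `2`, odd torsion
  order, analytic rank `0`: PRINT {guarded Thm-4.1 analogue `h41`, `hmod`, `hGZK`, Prop. 4.14@2 `h414`} + MEMO
  {K11 `hKato`} + CERTIFICATES {`TowerGapAtTwo W`, `2^n ≤ #Sel_{2^∞}(E/ℚ_j)[2]`, `λ_an = n`, `μ_an = 0`,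
  `0 ≤ ord₂ ϖ`}; the rank-`0` `2`-converse twin; the instance of item 19923 (`MissingLowerBoundAt W 2`).
* §2 the same at a SPLIT `2` (A236 `h41sp` + the named fact `greenberg_stevens W 2`; `λ_an = n + 1`, trivial
  zero included).
Compared with the INT doors (`…MultLowerHalfSelmerRank{,Split}`): the memo T-KATO2-NS/SPMULT (referee pending;
needs `ρ_{E,2^∞}` surjective ∧ `Δ < 0`) is traded for K11 (RC-2 PASS; every multiplicative class) plus ONE more
certificate (the tower gap, an UPPER layer count — today GRH-free only at `j′ ≤ 1`, CERT-TOWER-E1).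

WHAT IS DISPLAYED, NOT PROVED (numbers, not adjectives). MEMO: K11 (`hKato`). NAMED FACT beyond print: GS at `2`
(`hGS`, split only). PRINT: `h41`/`h41sp`, `hmod`, `hGZK`, `h414`. CERTIFICATES: tower gap (tower engines A/B;
run on 0/1 976 multiplicative classes today), layer count, `λ_an`/`μ_an` (two-engine 1 969/1 976), `hper₀`
(PRINT on the optimal / irreducible member by Česnavičius, displayed here). ∀-LEVEL CONTENT: none; 19923 and 19922
remain open as ∀-statements (seat verdicts).

References: R. Greenberg, LNM 1716 (1999), §1 p. 60, §3 pp. 85–86, §4 pp. 112–113, Prop. 4.14 (p. 124);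
K. Kato, Astérisque 295 (2004), Thm. 17.4, 17.13; L. Washington, *Introduction to Cyclotomic Fields*, §13.2;
B. Mazur, J. Tate, J. Teitelbaum, Invent. Math. 84 (1986), §I.10, §I.14–15, §II; R. Greenberg, G. Stevens,
Invent. Math. 111 (1993), (0.6); R. Greenberg, V. Vatsal, Invent. Math. 142 (2000), p. 4; R. L. Miller, LMS J.
Comput. Math. 14 (2011), Def. 1.1; K. Česnavičius, Thm. 1.2 (2018).
-/

set_option autoImplicit false
set_option linter.dupNamespace false

noncomputable section

open scoped Classical MatrixGroups ModularForm

open CongruenceSubgroup WeierstrassCurve Literature.NumberTheory.EllipticCurves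
  Literature.NumberTheory.EllipticCurves.ModularForms
  Literature.NumberTheory.EllipticCurves.Greenberg1999
  Literature.NumberTheory.EllipticCurves.Rank1Residual
  Literature.NumberTheory.EllipticCurves.Rank1Residual.Typed Summit.BirchSwinnertonDyer.Rank1Residual
  Summit.BirchSwinnertonDyer.Rank1Residual.X5 Summit.BirchSwinnertonDyer.Rank1Residual.X5.O1

namespace Summit.BirchSwinnertonDyer.BirchSwinnertonDyer.Theorems.MultSelmerRank

variable (W : WeierstrassCurve ℚ) [W.IsElliptic] [W.IsGloballyMinimal]

/-! ## §1 Non-split multiplicative `2` -/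

/-- **DOOR (TOWER λ-pinch, non-split): `BSDp W 2`, both halves,** for `W/ℚ` globally minimal of analytic rank `0`,
NON-SPLIT multiplicative at `2`, with ODD torsion order (`htors`; e.g. `E[2]` irreducible). Binders: PRINT
{guarded Thm-4.1 analogue `h41`, modularity `hmod`, GZK `hGZK`, Greenberg Prop. 4.14@2 `h414`}; MEMO {K11
`hKato : O1.KatoMultiplicativeDivisibilityRat W 2`}; CERTIFICATES {`TowerGapAtTwo W` (`hgap`: `X` torsion,
`μ(X) = 0`), the layer count `2^n ≤ #Sel_{2^∞}(E/ℚ_j)[2]` (`hsel`), `λ_an(E) = n` (`hlan`), `μ_an(E) = 0`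
(`hμan`), `0 ≤ ord₂ ϖ` (`hper₀`)}. Chain: `integralKato_of_katoRat_of_mu_eq_zero_of_period` ⇒ `X` torsion,
`g ∈ char X`, `ι g = ϖ·L`; `selmerLambdaLowerBoundAtTwo_of_layerSelmer` ⇒ `n ≤ λ(X)`;
`charIdeal_eq_span_of_katoInt_selmerPinch_nonsplit` ⇒ `char X = (g)`; `missingPPartAt_two_nonsplit_of_charIdeal_eq_span`
⇒ `ord₂ #Ш_an = ord₂ #Ш`; `bsdp_of_missingPPartAt`. No image hypothesis, no sign of `Δ`, no `2`-torsion point,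
no reference curve. [cite: Kato2004Asterisque, Thm. 17.4 (p. 273) and 17.13 (pp. 279–280)]
[cite: GreenbergLNM1716, §4 pp. 112–113 and Prop. 4.14 (p. 124)] [cite: GreenbergVatsal2000, p. 4 (after Thm. (1.2))]
[cite: Washington1997, §13.2] [cite: Miller2011LMS, Def. 1.1 and §1] -/
theorem bsdp_two_nonsplit_of_katoRat_of_towerGap_of_layerSelmer {j n : ℕ}
    (hKato : O1.KatoMultiplicativeDivisibilityRat W 2)
    (h41 : thm41Analogue_charValue_rankZero_numberField_anyPrime_oddLocalDegree)
    (hmod : nonempty_modularParametrizationData)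
    (hGZK : rank_eq_analyticRank_of_analyticRank_le_one)
    (h414 : prop414_noFiniteSubmodule_of_not_dvd_torsionOrder)
    (hper₀ : ∀ [NeZero (W.conductorNorm ℤ)] (f : CuspForm (Gamma0 (W.conductorNorm ℤ)) 2),
      IsNewformOf W f → ∀ ϖ : ℚ, (ϖ : ℝ) * W.realPeriodRat = plusPeriod f → 0 ≤ padicValRat 2 ϖ)
    (hgap : TowerGapAtTwo W) (htors : ¬ 2 ∣ W.torsionOrder)
    (hr : W.analyticRank = 0) (hmult : Mult W 2) (hns : ¬ W.HasSplitMultiplicativeReductionAtPrime 2)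
    (hlan : X2.AnalyticLambdaEq W 2 n) (hμan : X2.AnalyticMuLE W 2 0)
    (hsel : ∀ κ : ZpExtension ℚ 2, κ.IsCyclotomic →
      2 ^ n ≤ Nat.card {z : W.selmerLayer κ j // 2 • z = 0}) : BSDp W 2 := by
  haveI : NeZero (W.conductorNorm ℤ) := ⟨(W.conductorNorm_pos_holds).ne'⟩
  obtain ⟨Dm⟩ := hmod W
  have hf : IsNewformOf W Dm.f := Dm.isNewformOf
  have hL : W.entireLFunction 1 ≠ 0 :=
    (W.analyticRank_eq_zero_iff_holds hf.hasEntireLFunction).mp hr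
  obtain ⟨ϖ, -, hϖ, -⟩ := Dm.exists_rat_mul_realPeriodRat_eq_plusPeriod
  obtain ⟨κ, hκ, γ, hγ, hγ'⟩ := exists_isCyclotomic_isTopGenerator_isCyclotomicVariable_holds 2
  obtain ⟨DW⟩ := W.nonempty_selmerDualData_holds κ γ hγ
  obtain ⟨L, hLf⟩ := exists_isMultPAdicLFunctionOf_neg_one_of_nonsplit hf hmult hns
  obtain ⟨hX, hint, -⟩ := integralKato_of_katoRat_of_mu_eq_zero_of_period W hKato
    (mu_eq_zero_of_towerGapAtTwo W hgap) hper₀ hmult κ γ hκ hγ hγ' Dm.f hf ϖ hϖ DW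
  obtain ⟨g, hg, hι⟩ := hint hns L hLf
  have hchar := charIdeal_eq_span_of_katoInt_selmerPinch_nonsplit W hns hlan hμan hκ hγ hγ' hf hLf DW hX
    hϖ hι hg (selmerLambdaLowerBoundAtTwo_of_layerSelmer W h414 htors hsel)
  exact bsdp_of_missingPPartAt W 2 hGZK (by rw [hr]; exact zero_le_one)
    (missingPPartAt_two_nonsplit_of_charIdeal_eq_span W
      (twoAdicEulerCharRankZeroNonsplitMult_zero_of_greenberg' W h41) hGZK hmult hns hL hκ hγ hγ' hf hLf
      DW hX hϖ hι hchar)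

/-- **DOOR (TOWER λ-pinch, non-split), CONVERSE FORM** (S3ᵐ lane, rank-`0` `2`-converse at the class): the same
inputs MINUS analytic rank `0` and GZK; `Sel_{2^∞}(E/ℚ)` finite ⇒ `L(E,1) ≠ 0 ∧ r_an(E) = 0`.
[cite: Kato2004Asterisque, Thm. 17.4 (p. 273) and 17.13] [cite: GreenbergLNM1716, §4 pp. 112–113 and Prop. 4.14 (p. 124)]
[cite: MazurTateTeitelbaum1986Invent, §I.14] -/
theorem analyticRank_eq_zero_of_finite_selmer_of_katoRat_of_towerGap_of_layerSelmer {j n : ℕ}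
    (hKato : O1.KatoMultiplicativeDivisibilityRat W 2)
    (h41 : thm41Analogue_charValue_rankZero_numberField_anyPrime_oddLocalDegree)
    (hmod : nonempty_modularParametrizationData)
    (h414 : prop414_noFiniteSubmodule_of_not_dvd_torsionOrder)
    (hper₀ : ∀ [NeZero (W.conductorNorm ℤ)] (f : CuspForm (Gamma0 (W.conductorNorm ℤ)) 2),
      IsNewformOf W f → ∀ ϖ : ℚ, (ϖ : ℝ) * W.realPeriodRat = plusPeriod f → 0 ≤ padicValRat 2 ϖ)
    (hgap : TowerGapAtTwo W) (htors : ¬ 2 ∣ W.torsionOrder)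
    (hmult : Mult W 2) (hns : ¬ W.HasSplitMultiplicativeReductionAtPrime 2)
    (hlan : X2.AnalyticLambdaEq W 2 n) (hμan : X2.AnalyticMuLE W 2 0)
    (hsel : ∀ κ : ZpExtension ℚ 2, κ.IsCyclotomic →
      2 ^ n ≤ Nat.card {z : W.selmerLayer κ j // 2 • z = 0})
    (hfin : Finite (W.selmerGroupPInfty 2)) : W.entireLFunction 1 ≠ 0 ∧ W.analyticRank = 0 := by
  haveI : NeZero (W.conductorNorm ℤ) := ⟨(W.conductorNorm_pos_holds).ne'⟩
  obtain ⟨Dm⟩ := hmod W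
  have hf : IsNewformOf W Dm.f := Dm.isNewformOf
  obtain ⟨ϖ, -, hϖ, -⟩ := Dm.exists_rat_mul_realPeriodRat_eq_plusPeriod
  obtain ⟨κ, hκ, γ, hγ, hγ'⟩ := exists_isCyclotomic_isTopGenerator_isCyclotomicVariable_holds 2
  obtain ⟨DW⟩ := W.nonempty_selmerDualData_holds κ γ hγ
  obtain ⟨L, hLf⟩ := exists_isMultPAdicLFunctionOf_neg_one_of_nonsplit hf hmult hns
  obtain ⟨hX, hint, -⟩ := integralKato_of_katoRat_of_mu_eq_zero_of_period W hKato
    (mu_eq_zero_of_towerGapAtTwo W hgap) hper₀ hmult κ γ hκ hγ hγ' Dm.f hf ϖ hϖ DW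
  obtain ⟨g, hg, hι⟩ := hint hns L hLf
  have hchar := charIdeal_eq_span_of_katoInt_selmerPinch_nonsplit W hns hlan hμan hκ hγ hγ' hf hLf DW hX
    hϖ hι hg (selmerLambdaLowerBoundAtTwo_of_layerSelmer W h414 htors hsel)
  exact entireLFunction_one_ne_zero_of_finite_selmer_of_charIdeal_eq_span_nonsplit W
    (twoAdicEulerCharRankZeroNonsplitMult_zero_of_greenberg' W h41) hmult hns hκ hγ hγ' hf hLf DW hX hι
    hchar hfin

/-- **Item 19923 (`MultLowerHalfAtTwo`) AT a non-split odd-torsion curve on the TOWER λ-pinch road:**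
`Typed.MissingLowerBoundAt W 2` from PRINT {`h41`, `hmod`, `hGZK`, `h414`} + MEMO {K11 `hKato`} + CERTIFICATES
{tower gap, layer count, `λ_an = n`, `μ_an = 0`, `hper₀`} — through `BSDp W 2` and the finiteness of `Ш` at
analytic rank `0` (GZK). [cite: Miller2011LMS, Def. 1.1 (arXiv:1010.2431 p. 3)] [cite: GreenbergLNM1716, Prop. 4.14 (p. 124)] -/
theorem missingLowerBoundAt_two_nonsplit_of_katoRat_of_towerGap_of_layerSelmer {j n : ℕ}
    (hKato : O1.KatoMultiplicativeDivisibilityRat W 2)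
    (h41 : thm41Analogue_charValue_rankZero_numberField_anyPrime_oddLocalDegree)
    (hmod : nonempty_modularParametrizationData)
    (hGZK : rank_eq_analyticRank_of_analyticRank_le_one)
    (h414 : prop414_noFiniteSubmodule_of_not_dvd_torsionOrder)
    (hper₀ : ∀ [NeZero (W.conductorNorm ℤ)] (f : CuspForm (Gamma0 (W.conductorNorm ℤ)) 2),
      IsNewformOf W f → ∀ ϖ : ℚ, (ϖ : ℝ) * W.realPeriodRat = plusPeriod f → 0 ≤ padicValRat 2 ϖ)
    (hgap : TowerGapAtTwo W) (htors : ¬ 2 ∣ W.torsionOrder)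
    (hr : W.analyticRank = 0) (hmult : Mult W 2) (hns : ¬ W.HasSplitMultiplicativeReductionAtPrime 2)
    (hlan : X2.AnalyticLambdaEq W 2 n) (hμan : X2.AnalyticMuLE W 2 0)
    (hsel : ∀ κ : ZpExtension ℚ 2, κ.IsCyclotomic →
      2 ^ n ≤ Nat.card {z : W.selmerLayer κ j // 2 • z = 0}) : MissingLowerBoundAt W 2 := by
  haveI : Finite W.sha := (hGZK W (by rw [hr]; exact zero_le_one)).2
  exact (lower_and_upper_of_missingPPartAt W 2 (missingPPartAt_of_bsdp W 2
    (bsdp_two_nonsplit_of_katoRat_of_towerGap_of_layerSelmer W hKato h41 hmod hGZK h414 hper₀ hgap htors hr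
      hmult hns hlan hμan hsel))).1

/-! ## §2 Split multiplicative `2` -/

/-- **DOOR (TOWER λ-pinch, split): `BSDp W 2`, both halves,** for `W/ℚ` globally minimal of analytic rank `0`,
SPLIT multiplicative at `2`, with odd torsion order. Binders: PRINT {A236 `h41sp`, `hmod`, `hGZK`, `h414`}; the
named fact `greenberg_stevens W 2` (`hGS`); MEMO {K11 `hKato`}; CERTIFICATES {`TowerGapAtTwo W`, the layer count
`hsel`, `λ_an(E) = n + 1` (`hlan`, trivial zero included), `μ_an = 0`, `hper₀`}. Chain as in §1 with the split
twins (`ι(T·g) = ϖ·L`, `charIdeal_eq_span_of_katoIntSplit_selmerPinch`, `missingPPartAt_two_split_of_charIdeal_eq_span`).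
[cite: Kato2004Asterisque, Thm. 17.4 (p. 273) and 17.13 (pp. 279–280)] [cite: GreenbergLNM1716, §4 pp. 112–113 (split l_v) and Prop. 4.14 (p. 124)]
[cite: GreenbergStevens1993, Introduction (0.6)] [cite: MazurTateTeitelbaum1986Invent, §I.14–15 and §II]
[cite: Miller2011LMS, Def. 1.1 and §1] -/
theorem bsdp_two_split_of_katoRat_of_towerGap_of_layerSelmer {j n : ℕ}
    (hKato : O1.KatoMultiplicativeDivisibilityRat W 2)
    (h41sp : thm41Analogue_charValue_rankZero_split_baseChange_anyPrime)
    (hGS : greenberg_stevens (W := W) (p := 2))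
    (hmod : nonempty_modularParametrizationData)
    (hGZK : rank_eq_analyticRank_of_analyticRank_le_one)
    (h414 : prop414_noFiniteSubmodule_of_not_dvd_torsionOrder)
    (hper₀ : ∀ [NeZero (W.conductorNorm ℤ)] (f : CuspForm (Gamma0 (W.conductorNorm ℤ)) 2),
      IsNewformOf W f → ∀ ϖ : ℚ, (ϖ : ℝ) * W.realPeriodRat = plusPeriod f → 0 ≤ padicValRat 2 ϖ)
    (hgap : TowerGapAtTwo W) (htors : ¬ 2 ∣ W.torsionOrder)
    (hr : W.analyticRank = 0) (hmult : Mult W 2) (hsp : W.HasSplitMultiplicativeReductionAtPrime 2)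
    (hlan : X2.AnalyticLambdaEq W 2 (n + 1)) (hμan : X2.AnalyticMuLE W 2 0)
    (hsel : ∀ κ : ZpExtension ℚ 2, κ.IsCyclotomic →
      2 ^ n ≤ Nat.card {z : W.selmerLayer κ j // 2 • z = 0}) : BSDp W 2 := by
  haveI : NeZero (W.conductorNorm ℤ) := ⟨(W.conductorNorm_pos_holds).ne'⟩
  obtain ⟨Dm⟩ := hmod W
  have hf : IsNewformOf W Dm.f := Dm.isNewformOf
  have hL : W.entireLFunction 1 ≠ 0 :=
    (W.analyticRank_eq_zero_iff_holds hf.hasEntireLFunction).mp hr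
  obtain ⟨ϖ, -, hϖ, -⟩ := Dm.exists_rat_mul_realPeriodRat_eq_plusPeriod
  obtain ⟨κ, hκ, γ, hγ, hγ'⟩ := exists_isCyclotomic_isTopGenerator_isCyclotomicVariable_holds 2
  obtain ⟨DW⟩ := W.nonempty_selmerDualData_holds κ γ hγ
  obtain ⟨L, hLf⟩ := exists_isSplitMultPAdicLFunctionOf hsp hf
  obtain ⟨hX, -, hint⟩ := integralKato_of_katoRat_of_mu_eq_zero_of_period W hKato
    (mu_eq_zero_of_towerGapAtTwo W hgap) hper₀ hmult κ γ hκ hγ hγ' Dm.f hf ϖ hϖ DW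
  obtain ⟨g, hg, hι⟩ := hint hsp L hLf
  have hchar := charIdeal_eq_span_of_katoIntSplit_selmerPinch W hsp hlan hμan hκ hγ hγ' hf hLf DW hX hϖ hι
    hg (selmerLambdaLowerBoundAtTwo_of_layerSelmer W h414 htors hsel)
  exact bsdp_of_missingPPartAt W 2 hGZK (by rw [hr]; exact zero_le_one)
    (missingPPartAt_two_split_of_charIdeal_eq_span W
      (twoAdicEulerCharRankZeroSplitMult_zero_of_greenberg W h41sp) hGS hGZK hmult hsp hL hκ hγ hγ' hf hLf
      DW hX hϖ hι hchar)

/-- **DOOR (TOWER λ-pinch, split), CONVERSE FORM:** the same inputs MINUS analytic rank `0` and GZK;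
`Sel_{2^∞}(E/ℚ)` finite ⇒ `L(E,1) ≠ 0 ∧ r_an(E) = 0`.
[cite: Kato2004Asterisque, Thm. 17.4 (p. 273) and 17.13] [cite: GreenbergLNM1716, §4 pp. 112–113 and Prop. 4.14 (p. 124)]
[cite: MazurTateTeitelbaum1986Invent, §I.14–15 and §II] -/
theorem analyticRank_eq_zero_of_finite_selmer_of_katoRat_split_of_towerGap_of_layerSelmer {j n : ℕ}
    (hKato : O1.KatoMultiplicativeDivisibilityRat W 2)
    (h41sp : thm41Analogue_charValue_rankZero_split_baseChange_anyPrime)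
    (hGS : greenberg_stevens (W := W) (p := 2))
    (hmod : nonempty_modularParametrizationData)
    (h414 : prop414_noFiniteSubmodule_of_not_dvd_torsionOrder)
    (hper₀ : ∀ [NeZero (W.conductorNorm ℤ)] (f : CuspForm (Gamma0 (W.conductorNorm ℤ)) 2),
      IsNewformOf W f → ∀ ϖ : ℚ, (ϖ : ℝ) * W.realPeriodRat = plusPeriod f → 0 ≤ padicValRat 2 ϖ)
    (hgap : TowerGapAtTwo W) (htors : ¬ 2 ∣ W.torsionOrder)
    (hmult : Mult W 2) (hsp : W.HasSplitMultiplicativeReductionAtPrime 2)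
    (hlan : X2.AnalyticLambdaEq W 2 (n + 1)) (hμan : X2.AnalyticMuLE W 2 0)
    (hsel : ∀ κ : ZpExtension ℚ 2, κ.IsCyclotomic →
      2 ^ n ≤ Nat.card {z : W.selmerLayer κ j // 2 • z = 0})
    (hfin : Finite (W.selmerGroupPInfty 2)) : W.entireLFunction 1 ≠ 0 ∧ W.analyticRank = 0 := by
  haveI : NeZero (W.conductorNorm ℤ) := ⟨(W.conductorNorm_pos_holds).ne'⟩
  obtain ⟨Dm⟩ := hmod W
  have hf : IsNewformOf W Dm.f := Dm.isNewformOf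
  obtain ⟨ϖ, -, hϖ, -⟩ := Dm.exists_rat_mul_realPeriodRat_eq_plusPeriod
  obtain ⟨κ, hκ, γ, hγ, hγ'⟩ := exists_isCyclotomic_isTopGenerator_isCyclotomicVariable_holds 2
  obtain ⟨DW⟩ := W.nonempty_selmerDualData_holds κ γ hγ
  obtain ⟨L, hLf⟩ := exists_isSplitMultPAdicLFunctionOf hsp hf
  obtain ⟨hX, -, hint⟩ := integralKato_of_katoRat_of_mu_eq_zero_of_period W hKato
    (mu_eq_zero_of_towerGapAtTwo W hgap) hper₀ hmult κ γ hκ hγ hγ' Dm.f hf ϖ hϖ DW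
  obtain ⟨g, hg, hι⟩ := hint hsp L hLf
  have hchar := charIdeal_eq_span_of_katoIntSplit_selmerPinch W hsp hlan hμan hκ hγ hγ' hf hLf DW hX hϖ hι
    hg (selmerLambdaLowerBoundAtTwo_of_layerSelmer W h414 htors hsel)
  exact entireLFunction_one_ne_zero_of_finite_selmer_of_charIdeal_eq_span_split W
    (twoAdicEulerCharRankZeroSplitMult_zero_of_greenberg W h41sp) hGS hmult hsp hκ hγ hγ' hf hLf DW hX hι
    hchar hfin

/-- **Item 19923 (`MultLowerHalfAtTwo`) AT a split odd-torsion curve on the TOWER λ-pinch road:**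
`Typed.MissingLowerBoundAt W 2` from PRINT {A236, `hmod`, `hGZK`, `h414`} + `greenberg_stevens W 2` + MEMO {K11}
+ CERTIFICATES {tower gap, layer count, `λ_an = n + 1`, `μ_an = 0`, `hper₀`}.
[cite: Miller2011LMS, Def. 1.1 (arXiv:1010.2431 p. 3)] [cite: GreenbergLNM1716, Prop. 4.14 (p. 124)] -/
theorem missingLowerBoundAt_two_split_of_katoRat_of_towerGap_of_layerSelmer {j n : ℕ}
    (hKato : O1.KatoMultiplicativeDivisibilityRat W 2)
    (h41sp : thm41Analogue_charValue_rankZero_split_baseChange_anyPrime)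
    (hGS : greenberg_stevens (W := W) (p := 2))
    (hmod : nonempty_modularParametrizationData)
    (hGZK : rank_eq_analyticRank_of_analyticRank_le_one)
    (h414 : prop414_noFiniteSubmodule_of_not_dvd_torsionOrder)
    (hper₀ : ∀ [NeZero (W.conductorNorm ℤ)] (f : CuspForm (Gamma0 (W.conductorNorm ℤ)) 2),
      IsNewformOf W f → ∀ ϖ : ℚ, (ϖ : ℝ) * W.realPeriodRat = plusPeriod f → 0 ≤ padicValRat 2 ϖ)
    (hgap : TowerGapAtTwo W) (htors : ¬ 2 ∣ W.torsionOrder)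
    (hr : W.analyticRank = 0) (hmult : Mult W 2) (hsp : W.HasSplitMultiplicativeReductionAtPrime 2)
    (hlan : X2.AnalyticLambdaEq W 2 (n + 1)) (hμan : X2.AnalyticMuLE W 2 0)
    (hsel : ∀ κ : ZpExtension ℚ 2, κ.IsCyclotomic →
      2 ^ n ≤ Nat.card {z : W.selmerLayer κ j // 2 • z = 0}) : MissingLowerBoundAt W 2 := by
  haveI : Finite W.sha := (hGZK W (by rw [hr]; exact zero_le_one)).2
  exact (lower_and_upper_of_missingPPartAt W 2 (missingPPartAt_of_bsdp W 2
    (bsdp_two_split_of_katoRat_of_towerGap_of_layerSelmer W hKato h41sp hGS hmod hGZK h414 hper₀ hgap htors hr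
      hmult hsp hlan hμan hsel))).1

end Summit.BirchSwinnertonDyer.BirchSwinnertonDyer.Theorems.MultSelmerRank

end
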